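import Summits.QuantumFields.YangMills.Theorems.ColdStartUniversalityLatticeLangevinDynkinSZZ
import Summits.QuantumFields.YangMills.Theorems.ColdStartUniversalityLatticeLangevinFeller
import Mathlib.MeasureTheory.Integral.DominatedConvergence
import HarnessLib

/-!
# Route `ColdStartUniversality`, crux K_A1 `UniformColdStartMixing` (stmt-QuantumFields-24809), rung `stub_fixedCutoffMixing`:
# G-block, brick G2a — Dynkin's formula in forward (integrated) form with a continuous integrand

Helper file (seat `ym-line-csu-p1`, g7).  For the SU(2) lattice Langevin (SZZ) system and a `C³` compactly supported test
function `f` of the real link coordinates, along any solution family with the regular-flow measurability clause: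
`r ↦ E (𝓛f)(X_r)` and `r ↦ E f(X_r)` are continuous (dominated convergence along the a.s. continuous paths) and
`E f(X_τ) = f(x) + ∫₀^τ E (𝓛f)(X_r) dr` (`dynkin_forward`; from `dynkin_expectation_szz` and Fubini).  This is the input of the
time-dependent Dynkin formula for separable test functions (brick G2b) used by the ground-state (super)solution arguments.
No definition, no sorry.  RECORD-rung R3 plumbing; nothing here bears on the mass gap.
-/

set_option autoImplicit false

noncomputable section

namespace Summit.QuantumFields.YangMills.Theorems.ColdStartUniversality

open MeasureTheory ProbabilityTheory Finset Filter Topology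
open scoped NNReal
open Literature.Probability.Process Literature.MathematicalPhysics.QuantumFieldTheory
open Literature.MathematicalPhysics.QuantumLattice (fundamentalRep fundamentalLatticeRep continuous_fundamentalRep)

variable {L : ℕ} [NeZero L]

omit [NeZero L] in
/-- The real link coordinates `V ↦ (Re/Im ρ(V_e)_{ij})` are continuous. [folklore] -/
theorem continuous_coords :
    Continuous fun (V : GaugeConfig 3 L (Matrix.specialUnitaryGroup (Fin 2) ℂ)) (q : Edge 3 L × Fin 2 × Fin 2 × Bool) =>
      (fun z : ℂ => if q.2.2.2 then z.im else z.re)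
        ((fundamentalRep (Fin 2) (V q.1) : Matrix (Fin 2) (Fin 2) ℂ) q.2.1 q.2.2.1) := by
  refine continuous_pi fun q => ?_
  have hc : Continuous fun V : GaugeConfig 3 L (Matrix.specialUnitaryGroup (Fin 2) ℂ) =>
      ((fundamentalRep (Fin 2) (V q.1) : Matrix (Fin 2) (Fin 2) ℂ) q.2.1 q.2.2.1) :=
    (continuous_apply q.2.2.1).comp ((continuous_apply q.2.1).comp
      ((continuous_fundamentalRep (n := Fin 2)).comp (continuous_apply q.1)))
  cases q.2.2.2
  · exact Complex.continuous_re.comp hc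
  · exact Complex.continuous_im.comp hc

/-- **The coordinate generator of a `C²` function is a continuous observable on `SU(2)^E`.** [folklore] -/
theorem continuous_generator (β : ℝ) {f : (Edge 3 L × Fin 2 × Fin 2 × Bool → ℝ) → ℝ} (hf : ContDiff ℝ 2 f) :
    Continuous fun V : GaugeConfig 3 L (Matrix.specialUnitaryGroup (Fin 2) ℂ) =>
      (∑ i : Edge 3 L × Fin 2 × Fin 2 × Bool,
        fderiv ℝ f (fun q : Edge 3 L × Fin 2 × Fin 2 × Bool => (fun z : ℂ => if q.2.2.2 then z.im else z.re)
            ((fundamentalRep (Fin 2) (V q.1) : Matrix (Fin 2) (Fin 2) ℂ) q.2.1 q.2.2.1)) (Pi.single i 1) *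
          (fun z : ℂ => if i.2.2.2 then z.im else z.re)
            ((latticeLangevinDynamics (fundamentalLatticeRep 2) β).drift
              (matrixConfig (fundamentalRep (Fin 2)) V) i.1 i.2.1 i.2.2.1) +
      1 / 2 * ∑ i : Edge 3 L × Fin 2 × Fin 2 × Bool, ∑ j : Edge 3 L × Fin 2 × Fin 2 × Bool,
        fderiv ℝ (fun z => fderiv ℝ f z (Pi.single i 1))
            (fun q : Edge 3 L × Fin 2 × Fin 2 × Bool => (fun z : ℂ => if q.2.2.2 then z.im else z.re)
              ((fundamentalRep (Fin 2) (V q.1) : Matrix (Fin 2) (Fin 2) ℂ) q.2.1 q.2.2.1)) (Pi.single j 1) *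
          ∑ n : Edge 3 L × NoiseIdx 2,
            (if n.1 = i.1 then (fun z : ℂ => if i.2.2.2 then z.im else z.re)
              ((latticeLangevinDynamics (fundamentalLatticeRep 2) β).noise
                (matrixConfig (fundamentalRep (Fin 2)) V) i.1 n.2 i.2.1 i.2.2.1) else 0) *
            (if n.1 = j.1 then (fun z : ℂ => if j.2.2.2 then z.im else z.re)
              ((latticeLangevinDynamics (fundamentalLatticeRep 2) β).noise
                (matrixConfig (fundamentalRep (Fin 2)) V) j.1 n.2 j.2.1 j.2.2.1) else 0)) := by
  have hco := continuous_coords (L := L)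
  have hreim : ∀ (c : Bool) {g : GaugeConfig 3 L (Matrix.specialUnitaryGroup (Fin 2) ℂ) → ℂ}, Continuous g →
      Continuous fun V => (fun z : ℂ => if c then z.im else z.re) (g V) := by
    intro c g hg; cases c
    · exact Complex.continuous_re.comp hg
    · exact Complex.continuous_im.comp hg
  have hd1 : ∀ v, Continuous fun y : Edge 3 L × Fin 2 × Fin 2 × Bool → ℝ => fderiv ℝ f y v := fun v =>
    (hf.continuous_fderiv (by norm_num)).clm_apply continuous_const
  have hd2 : ∀ v w, Continuous fun y : Edge 3 L × Fin 2 × Fin 2 × Bool → ℝ =>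
      fderiv ℝ (fun z => fderiv ℝ f z v) y w := by
    intro v w
    have h1 : ContDiff ℝ 1 (fun z => fderiv ℝ f z v) := by
      have hd : ContDiff ℝ 1 (fderiv ℝ f) := hf.fderiv_right (m := 1) (by norm_num)
      exact (ContinuousLinearMap.apply ℝ ℝ v).contDiff.comp hd
    exact (h1.continuous_fderiv (by norm_num)).clm_apply continuous_const
  have hdrift : ∀ i : Edge 3 L × Fin 2 × Fin 2 × Bool, Continuous fun V : GaugeConfig 3 L
      (Matrix.specialUnitaryGroup (Fin 2) ℂ) => (fun z : ℂ => if i.2.2.2 then z.im else z.re)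
        ((latticeLangevinDynamics (fundamentalLatticeRep 2) β).drift (matrixConfig (fundamentalRep (Fin 2)) V)
          i.1 i.2.1 i.2.2.1) := fun i =>
    hreim _ ((continuous_apply i.2.2.1).comp ((continuous_apply i.2.1).comp (continuous_drift_matrixConfig β i.1)))
  have hnoise : ∀ (i : Edge 3 L × Fin 2 × Fin 2 × Bool) (n : Edge 3 L × NoiseIdx 2), Continuous fun V : GaugeConfig 3 L
      (Matrix.specialUnitaryGroup (Fin 2) ℂ) => (if n.1 = i.1 then (fun z : ℂ => if i.2.2.2 then z.im else z.re)
        ((latticeLangevinDynamics (fundamentalLatticeRep 2) β).noise (matrixConfig (fundamentalRep (Fin 2)) V)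
          i.1 n.2 i.2.1 i.2.2.1) else 0) := by
    intro i n
    by_cases h : n.1 = i.1
    · simp only [if_pos h]
      exact hreim _ ((continuous_apply i.2.2.1).comp ((continuous_apply i.2.1).comp
        (continuous_noise_matrixConfig β i.1 n.2)))
    · simp only [if_neg h]; exact continuous_const
  refine Continuous.add (continuous_finsetSum _ fun i _ => ((hd1 _).comp hco).mul (hdrift i)) ?_
  refine continuous_const.mul (continuous_finsetSum _ fun i _ => continuous_finsetSum _ fun j _ => ?_)
  exact ((hd2 _ _).comp hco).mul (continuous_finsetSum _ fun n _ => (hnoise i n).mul (hnoise j n))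

/-- **Dynkin's formula, forward form, with continuous integrand.**  Along a solution family of the SU(2) SZZ system
with the regular-flow measurability clause, for a `C³` compactly supported `f` of the real link coordinates:
`r ↦ E f(X_r)` and `r ↦ E (𝓛f)(X_r)` are continuous and `E f(X_τ) = f(x) + ∫₀^τ E (𝓛f)(X_r) dr` for `τ ≥ 0`
(real time through `toNNReal`). [folklore] -/
theorem dynkin_forward (β : ℝ) {Ω : Type} [MeasurableSpace Ω] {P : Measure Ω}
    [IsProbabilityMeasure P] {W : ℝ≥0 → Ω → (Edge 3 L × NoiseIdx 2 → ℝ)} (hW : IsFlatBrownian W P)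
    (U : GaugeConfig 3 L (Matrix.specialUnitaryGroup (Fin 2) ℂ) → ℝ≥0 → Ω →
      GaugeConfig 3 L (Matrix.specialUnitaryGroup (Fin 2) ℂ))
    (hU : ∀ x, (∀ ω, U x 0 ω = x) ∧
      (latticeLangevinDynamics (fundamentalLatticeRep 2) β).IsSolution (fundamentalRep (Fin 2))
        hW.natFiltration P W (U x))
    (hUm : ∀ i : ℝ≥0, Measurable[@Prod.instMeasurableSpace (Set.Iic i)
        (GaugeConfig 3 L (Matrix.specialUnitaryGroup (Fin 2) ℂ) × Ω) inferInstance
        (@Prod.instMeasurableSpace (GaugeConfig 3 L (Matrix.specialUnitaryGroup (Fin 2) ℂ)) Ω inferInstance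
          (hW.natFiltration i))]
      (fun q : Set.Iic i × (GaugeConfig 3 L (Matrix.specialUnitaryGroup (Fin 2) ℂ) × Ω) => U q.2.1 q.1 q.2.2))
    (x : GaugeConfig 3 L (Matrix.specialUnitaryGroup (Fin 2) ℂ))
    {f : (Edge 3 L × Fin 2 × Fin 2 × Bool → ℝ) → ℝ} (hf : ContDiff ℝ 3 f) (hfc : HasCompactSupport f) :
    let coords : GaugeConfig 3 L (Matrix.specialUnitaryGroup (Fin 2) ℂ) → (Edge 3 L × Fin 2 × Fin 2 × Bool → ℝ) :=
      fun V q => (fun z : ℂ => if q.2.2.2 then z.im else z.re)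
        ((fundamentalRep (Fin 2) (V q.1) : Matrix (Fin 2) (Fin 2) ℂ) q.2.1 q.2.2.1)
    let gen : GaugeConfig 3 L (Matrix.specialUnitaryGroup (Fin 2) ℂ) → ℝ := fun V =>
      (∑ i : Edge 3 L × Fin 2 × Fin 2 × Bool, fderiv ℝ f (coords V) (Pi.single i 1) *
          (fun z : ℂ => if i.2.2.2 then z.im else z.re)
            ((latticeLangevinDynamics (fundamentalLatticeRep 2) β).drift
              (matrixConfig (fundamentalRep (Fin 2)) V) i.1 i.2.1 i.2.2.1) +
      1 / 2 * ∑ i : Edge 3 L × Fin 2 × Fin 2 × Bool, ∑ j : Edge 3 L × Fin 2 × Fin 2 × Bool,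
        fderiv ℝ (fun z => fderiv ℝ f z (Pi.single i 1)) (coords V) (Pi.single j 1) *
          ∑ n : Edge 3 L × NoiseIdx 2,
            (if n.1 = i.1 then (fun z : ℂ => if i.2.2.2 then z.im else z.re)
              ((latticeLangevinDynamics (fundamentalLatticeRep 2) β).noise
                (matrixConfig (fundamentalRep (Fin 2)) V) i.1 n.2 i.2.1 i.2.2.1) else 0) *
            (if n.1 = j.1 then (fun z : ℂ => if j.2.2.2 then z.im else z.re)
              ((latticeLangevinDynamics (fundamentalLatticeRep 2) β).noise
                (matrixConfig (fundamentalRep (Fin 2)) V) j.1 n.2 j.2.1 j.2.2.1) else 0))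
    Continuous (fun r : ℝ => ∫ ω, f (coords (U x r.toNNReal ω)) ∂P) ∧
      Continuous (fun r : ℝ => ∫ ω, gen (U x r.toNNReal ω) ∂P) ∧
      ∀ τ : ℝ, 0 ≤ τ → ∫ ω, f (coords (U x τ.toNNReal ω)) ∂P =
        f (coords x) + ∫ r in (0 : ℝ)..τ, ∫ ω, gen (U x r.toNNReal ω) ∂P := by
  intro coords gen
  classical
  haveI := secondCountableTopology_su2
  haveI := borelSpace_config L
  -- continuity and bounds of the two observables
  have hco : Continuous coords := continuous_coords (L := L)
  have hObs_cont : Continuous fun V => f (coords V) := hf.continuous.comp hco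
  have hgen_cont : Continuous gen := continuous_generator (L := L) β (hf.of_le (by norm_num))
  obtain ⟨Mf, -, hMf⟩ := exists_abs_le_of_continuous hObs_cont
  obtain ⟨Mg, -, hMg⟩ := exists_abs_le_of_continuous hgen_cont
  -- measurability along the flow
  have hmeasU : ∀ r : ℝ≥0, Measurable (U x r) := fun r => ((hU x).2.adapted r).mono (hW.natFiltration.le r) le_rfl
  have hObs_t : ∀ r : ℝ≥0, Measurable fun ω => f (coords (U x r ω)) := fun r => hObs_cont.measurable.comp (hmeasU r)
  have hgen_t : ∀ r : ℝ≥0, Measurable fun ω => gen (U x r ω) := fun r => hgen_cont.measurable.comp (hmeasU r)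
  have hgen_joint : Measurable fun p : Ω × ℝ => gen (U x p.2.toNNReal p.1) :=
    measurable_comp_flow_toNNReal hUm x hgen_cont.measurable
  have hint_f : ∀ r : ℝ≥0, Integrable (fun ω => f (coords (U x r ω))) P := fun r =>
    Integrable.of_bound (hObs_t r).aestronglyMeasurable Mf (Eventually.of_forall fun ω => by
      rw [Real.norm_eq_abs]; exact hMf _)
  have hint_g : ∀ r : ℝ≥0, Integrable (fun ω => gen (U x r ω)) P := fun r =>
    Integrable.of_bound (hgen_t r).aestronglyMeasurable Mg (Eventually.of_forall fun ω => by
      rw [Real.norm_eq_abs]; exact hMg _)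
  -- continuity in time by dominated convergence along the a.s. continuous paths
  have hpath := (hU x).2.continuous
  have hcontf : Continuous (fun r : ℝ => ∫ ω, f (coords (U x r.toNNReal ω)) ∂P) := by
    refine continuous_of_dominated (bound := fun _ => Mf) (fun r => (hObs_t _).aestronglyMeasurable)
      (fun r => Eventually.of_forall fun ω => by rw [Real.norm_eq_abs]; exact hMf _) (integrable_const Mf) ?_
    filter_upwards [hpath] with ω hω
    exact hObs_cont.comp (hω.comp continuous_real_toNNReal)
  have hcontg : Continuous (fun r : ℝ => ∫ ω, gen (U x r.toNNReal ω) ∂P) := by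
    refine continuous_of_dominated (bound := fun _ => Mg) (fun r => (hgen_t _).aestronglyMeasurable)
      (fun r => Eventually.of_forall fun ω => by rw [Real.norm_eq_abs]; exact hMg _) (integrable_const Mg) ?_
    filter_upwards [hpath] with ω hω
    exact hgen_cont.comp (hω.comp continuous_real_toNNReal)
  refine ⟨hcontf, hcontg, fun τ hτ => ?_⟩
  -- Dynkin's formula between `0` and `τ`
  have hZ : StronglyMeasurable[hW.natFiltration 0] (fun _ : Ω => (1 : ℝ)) := stronglyMeasurable_const
  set r₁ : ℝ≥0 := τ.toNNReal with hr₁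
  have hD := dynkin_expectation_szz L β hW U hU hUm x hf hfc (show (0 : ℝ≥0) ≤ r₁ from bot_le) hZ (C := 1)
    (fun _ => by simp)
  dsimp only at hD
  simp_rw [one_mul] at hD
  have hL : ∫ ω, (f (coords (U x r₁ ω)) - f (coords (U x 0 ω))) ∂P =
      ∫ ω, f (coords (U x τ.toNNReal ω)) ∂P - f (coords x) := by
    rw [integral_sub (hint_f r₁) (hint_f 0)]
    simp only [hr₁, (hU x).1, integral_const, smul_eq_mul, probReal_univ, one_mul]
  have hR : ∫ ω, (∫ u in Set.Ioc (0 : ℝ) r₁, gen (U x u.toNNReal ω)) ∂P =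
      ∫ r in (0 : ℝ)..τ, ∫ ω, gen (U x r.toNNReal ω) ∂P := by
    have hrτ : ((r₁ : ℝ≥0) : ℝ) = τ := by rw [hr₁, Real.coe_toNNReal τ hτ]
    rw [hrτ, intervalIntegral.integral_of_le hτ]
    have hI : Integrable (Function.uncurry fun (ω : Ω) (u : ℝ) => gen (U x u.toNNReal ω))
        (P.prod (volume.restrict (Set.Ioc (0 : ℝ) τ))) := by
      refine Integrable.of_bound ?_ Mg (Eventually.of_forall fun p => ?_)
      · exact hgen_joint.stronglyMeasurable.aestronglyMeasurable
      · rcases p with ⟨ω, u⟩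
        rw [Function.uncurry_apply_pair, Real.norm_eq_abs]
        exact hMg _
    rw [integral_integral_swap hI]
  have hD' : ∫ ω, (f (coords (U x r₁ ω)) - f (coords (U x 0 ω))) ∂P =
      ∫ ω, (∫ u in Set.Ioc (0 : ℝ) r₁, gen (U x u.toNNReal ω)) ∂P := hD
  rw [hL, hR] at hD'
  linarith

end Summit.QuantumFields.YangMills.Theorems.ColdStartUniversality

end
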